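import Summits.Ventures.QEC.Census.CertBZInfoSets
import Summits.Ventures.QEC.Census.BB.BB144.BZData
import HarnessLib

/-!
# `BB144` — `bz` certificate, side Z: INFORMATION-SET facts (systematic form), tier KERNEL, file 2/2
# (PARTITION v2.6 item S7.BZI; emitted by qec-search-7)

For each (block `b`, matrix `i`) listed: `cert.bzZSys bzData b i = true` by `decide +kernel` — the matrix
`G_i = A_i · G_b` (rows = the stated XOR-selections of the rows of the block matrix `G_b` = pivot rows of the
stabilizer matrix ++ the block's logical combinations) is SYSTEMATIC on its information set `T_i` (CERT-FORMAT C3: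
`G_i[j][T_i[j']] = [j = j']`, hence `A_i` invertible and every block codeword `c = (c|_T) · G_i` — type-07's
`eq_sum_smul_of_systematic`), and its rows are words `< 2^144`. These are the `hsys` / `hG` inputs of
`BZAssembly.forall_lt_of_bz`, KERNEL-checked independently of the (COMPILED) enumeration verdicts `BZEnumZ*.lean`;
`CertBZInfoSets.bzZBlock_of_parts` recombines sys + enum + bound into type-10's `bzZBlock`.
-/

namespace Summit.Ventures.QEC.Census.BB144

/-- Block 55, matrix 0 (|T| = 72, relRank 72, depth 5): `G` systematic on `T`, rows `< 2^144` (kernel). -/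
theorem sysZ_55_0 : cert.bzZSys bzData 55 0 = true := by decide +kernel

/-- Block 55, matrix 1 (|T| = 72, relRank 72, depth 5): `G` systematic on `T`, rows `< 2^144` (kernel). -/
theorem sysZ_55_1 : cert.bzZSys bzData 55 1 = true := by decide +kernel

/-- Block 56, matrix 0 (|T| = 72, relRank 72, depth 5): `G` systematic on `T`, rows `< 2^144` (kernel). -/
theorem sysZ_56_0 : cert.bzZSys bzData 56 0 = true := by decide +kernel

/-- Block 56, matrix 1 (|T| = 72, relRank 72, depth 5): `G` systematic on `T`, rows `< 2^144` (kernel). -/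
theorem sysZ_56_1 : cert.bzZSys bzData 56 1 = true := by decide +kernel

/-- Block 57, matrix 0 (|T| = 72, relRank 72, depth 5): `G` systematic on `T`, rows `< 2^144` (kernel). -/
theorem sysZ_57_0 : cert.bzZSys bzData 57 0 = true := by decide +kernel

/-- Block 57, matrix 1 (|T| = 72, relRank 71, depth 6): `G` systematic on `T`, rows `< 2^144` (kernel). -/
theorem sysZ_57_1 : cert.bzZSys bzData 57 1 = true := by decide +kernel

/-- Block 58, matrix 0 (|T| = 72, relRank 72, depth 5): `G` systematic on `T`, rows `< 2^144` (kernel). -/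
theorem sysZ_58_0 : cert.bzZSys bzData 58 0 = true := by decide +kernel

/-- Block 58, matrix 1 (|T| = 72, relRank 72, depth 5): `G` systematic on `T`, rows `< 2^144` (kernel). -/
theorem sysZ_58_1 : cert.bzZSys bzData 58 1 = true := by decide +kernel

/-- Block 59, matrix 0 (|T| = 72, relRank 72, depth 5): `G` systematic on `T`, rows `< 2^144` (kernel). -/
theorem sysZ_59_0 : cert.bzZSys bzData 59 0 = true := by decide +kernel

/-- Block 59, matrix 1 (|T| = 72, relRank 72, depth 5): `G` systematic on `T`, rows `< 2^144` (kernel). -/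
theorem sysZ_59_1 : cert.bzZSys bzData 59 1 = true := by decide +kernel

/-- Block 60, matrix 0 (|T| = 72, relRank 72, depth 5): `G` systematic on `T`, rows `< 2^144` (kernel). -/
theorem sysZ_60_0 : cert.bzZSys bzData 60 0 = true := by decide +kernel

/-- Block 60, matrix 1 (|T| = 72, relRank 72, depth 5): `G` systematic on `T`, rows `< 2^144` (kernel). -/
theorem sysZ_60_1 : cert.bzZSys bzData 60 1 = true := by decide +kernel

/-- Block 61, matrix 0 (|T| = 72, relRank 72, depth 5): `G` systematic on `T`, rows `< 2^144` (kernel). -/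
theorem sysZ_61_0 : cert.bzZSys bzData 61 0 = true := by decide +kernel

/-- Block 61, matrix 1 (|T| = 72, relRank 72, depth 5): `G` systematic on `T`, rows `< 2^144` (kernel). -/
theorem sysZ_61_1 : cert.bzZSys bzData 61 1 = true := by decide +kernel

/-- Block 62, matrix 0 (|T| = 72, relRank 72, depth 5): `G` systematic on `T`, rows `< 2^144` (kernel). -/
theorem sysZ_62_0 : cert.bzZSys bzData 62 0 = true := by decide +kernel

/-- Block 62, matrix 1 (|T| = 72, relRank 72, depth 5): `G` systematic on `T`, rows `< 2^144` (kernel). -/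
theorem sysZ_62_1 : cert.bzZSys bzData 62 1 = true := by decide +kernel

/-- Block 63, matrix 0 (|T| = 72, relRank 72, depth 5): `G` systematic on `T`, rows `< 2^144` (kernel). -/
theorem sysZ_63_0 : cert.bzZSys bzData 63 0 = true := by decide +kernel

/-- Block 63, matrix 1 (|T| = 72, relRank 71, depth 6): `G` systematic on `T`, rows `< 2^144` (kernel). -/
theorem sysZ_63_1 : cert.bzZSys bzData 63 1 = true := by decide +kernel

/-- Block 64, matrix 0 (|T| = 72, relRank 72, depth 5): `G` systematic on `T`, rows `< 2^144` (kernel). -/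
theorem sysZ_64_0 : cert.bzZSys bzData 64 0 = true := by decide +kernel

/-- Block 64, matrix 1 (|T| = 72, relRank 72, depth 5): `G` systematic on `T`, rows `< 2^144` (kernel). -/
theorem sysZ_64_1 : cert.bzZSys bzData 64 1 = true := by decide +kernel

end Summit.Ventures.QEC.Census.BB144
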